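import Literature.NumberTheory.EllipticCurves.MordellCurveThreeDescentFiniteField
import Mathlib.NumberTheory.Padics.Hensel
import Mathlib.NumberTheory.Padics.RingHoms
import Mathlib.NumberTheory.Padics.HeightOneSpectrum
import Mathlib.NumberTheory.NumberField.Completion.InfinitePlace
import Mathlib.NumberTheory.NumberField.InfinitePlace.TotallyRealComplex
import Mathlib.Analysis.SpecialFunctions.Pow.Real
import HarnessLib

/-!
# Cassels' torsors `m x³ + m⁻¹ y³ + d z³ = 0` are everywhere locally soluble (descent form)

Topic `NumberTheory/EllipticCurves`. Sixth file of the programme towards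
`Literature.Barriers.BirchSwinnertonDyer.Cassels1964_sha_threeRank_jZero` (Cassels 1964,
*Arithmetic on curves of genus 1, VI. The Tate–Šafarevič group can be arbitrarily large*,
J. reine angew. Math. 214/215, 65–70): the **local half** of the printed Theorem — "there are
points on (2) `m x³ + m⁻¹ y³ + d z³ = 0`, `m | P²`, everywhere locally" — for every squarefree
`d ≠ 0` all of whose prime factors are `≡ 8 (mod 9)` (Cassels' `d` of (8) included), in the
descent language of `MordellCurveThreeDescentLocal` / the (LOCAL) binder of
`Cassels1964_sha_threeRank_jZero_of_local_global`
(`Literature/Barriers/BirchSwinnertonDyer/DescentDefectUnboundedCasselsProofs.lean`): for every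
monomial `m` in the primes of `d` and every completion `ℚ_v` of `ℚ`, `m ≡ phiDescent (12d) P'`
modulo cubes for some `P' ∈ C'_d(ℚ_v)`. Everything here is proved; the only definition is the
predicate `IsDescentValue` naming that condition; no named facts.

Cassels (p. 66): "the only `p`-adic fields in which there might not be points on (2) are the
`3`-adic field and the `q`-adic fields with `q | d`. That there are `3`-adic points follows from
(6) [`m ≡ ±1 (mod 9)` is a `3`-adic cube]. There are `q`-adic points with `z = 0` unless `q ∣ m`,
`q² ∤ m`, and then `(0, (d q^{-1} m)^{1/3}, −1)` will do". In descent form, place by place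
(`c = 12d`, `E' = C'_d : Y² = X³ + 81c²`, `δ = phiDescent c`: `O ↦ 1`, `T' = (0, 9c) ↦ 18c = 6³d`,
`−T' ↦ (18c)²`, `(X, Y) ↦ Y + 9c`), for a prime generator `q | d` of the monomials:
* `ℓ = 3`: `q ≡ −1 (mod 9)` is a cube in `ℤ₃` (Hensel at precision `27`,
  `padicInt_three_exists_pow_three_eq`), so `q = δ(O) q`-trivially: `IsDescentValue.of_cube`.
* `ℓ | d`, `ℓ ≠ q`: `q` is an `ℓ`-adic unit and `ℓ ≡ 2 (mod 3)`, so `q` is a cube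
  (`padicInt_exists_pow_three_eq_of_mod_three_ne_one`).
* `ℓ = q`: `δ(T') = 18c = 6³ d = q · (6 ∛(d/q))³`, `d/q` a `q`-adic unit, hence a cube
  (`padic_isDescentValue_self`) — Cassels' point `(0, (d/q)^{1/3}, −1)`.
* `ℓ ∤ 3d`, `ℓ ≡ 2 (mod 3)` (including `ℓ = 2`): units are cubes.
* `ℓ ∤ 3d`, `ℓ ≡ 1 (mod 3)` — the good primes, where Cassels says nothing because (2) visibly has
  smooth reduction and a point by Hasse–Weil; in descent form this is the one place needing an
  argument: the descent map is onto the unit classes. We get it from the finite-field surjectivity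
  `exists_cubicDescent_eq_of_finite` (file `MordellCurveThreeDescentFiniteField`: `#E(𝔽_ℓ) = #E'(𝔽_ℓ)`
  for isogenous curves + `ker δ̄ = φ(E(𝔽_ℓ))`) and Hensel lifting (`padic_isDescentValue_of_good`).
* `∞`: positive reals are cubes.
Products: descent values form a group (`exists_phiDescent_add_eq` of `MordellCurvePhiDescentHom`),
so monomials in the `q` follow (`IsDescentValue.prod_pow`); transport to Mathlib's completions
`v.adicCompletion ℚ ≃ ℚ_p` (`Rat.HeightOneSpectrum.adicCompletion.padicEquiv`) and
`w.Completion ≃ ℝ` along `IsDescentValue.map`, as in `KramerDescentLocalGeneratorsProofs`.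

Main statement: `cassels_torsors_locally_soluble`.

## References

* [Cassels1964ArithmeticVI] J. W. S. Cassels, J. reine angew. Math. 214/215 (1964) 65–70,
  Theorem and p. 66.
* [Serre1973] J.-P. Serre, *A Course in Arithmetic*, GTM 7, Ch. II §2.2 (Hensel; cubes in `ℤ_p`).
-/

noncomputable section

open scoped Classical

open WeierstrassCurve

universe u

namespace Literature.NumberTheory.EllipticCurves

namespace MordellDescent

/-! ## `a` is a `φ`-descent value times a cube over `F` -/

section Pred

variable {F : Type*} [Field F]

/-- **`IsDescentValue c a`**: over the field `F`, `a` is a value of the `φ`-descent map times a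
cube — there are `P' ∈ E'(F) = E_{81c²}(F)` and `w ∈ F*` with `phiDescent c P' = a w³`
(`phiDescent`: `O ↦ 1`, `−T' = (0, −9c) ↦ (18c)²`, `(X, Y) ↦ Y + 9c`). For `F` a completion of
`ℚ`, `c = 12d`, `a = m` this is the local solubility of Cassels' torsor `m x³ + m⁻¹ y³ + d z³ = 0`
in descent form — the hypothesis of `torsorClass_mem_localRestrictionKer` and the shape of the
(LOCAL) binder of `Cassels1964_sha_threeRank_jZero_of_local_global`. [cite: Cassels1964ArithmeticVI, p. 65] -/
def IsDescentValue (c a : F) : Prop :=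
  ∃ (P : (mordellCurve (81 * c ^ 2)).toAffine.Point) (w : F), w ≠ 0 ∧ phiDescent c P = a * w ^ 3

/-- A non-zero cube is a descent value (`P' = O`). [folklore] -/
theorem IsDescentValue.of_eq_cube {c a w : F} (hw : w ≠ 0) (h : a * w ^ 3 = 1) : IsDescentValue c a :=
  ⟨0, w, hw, by rw [phiDescent_zero, h]⟩

/-- `a = z³` with `z ≠ 0` is a descent value. [folklore] -/
theorem IsDescentValue.of_cube {c a z : F} (hz : z ≠ 0) (h : a = z ^ 3) : IsDescentValue c a :=
  IsDescentValue.of_eq_cube (inv_ne_zero hz) (by rw [h, inv_pow, mul_inv_cancel₀ (pow_ne_zero 3 hz)])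

variable [CharZero F]

/-- The points `±T' = (0, ±9c)` of `E'(F)`. [folklore] -/
theorem nonsingular_T' {c : F} (hc : c ≠ 0) (ε : F) (hε : ε ^ 2 = 1) :
    (mordellCurve (81 * c ^ 2)).toAffine.Nonsingular 0 (ε * (9 * c)) :=
  nonsingular_mordellCurve_of_equation (mul_ne_zero (by norm_num) (pow_ne_zero 2 hc))
    ((mordellCurve_equation_iff _ _ _).mpr (by rw [mul_pow, hε]; ring))

/-- If `18c = a w³` then `a` is a descent value (`P' = T' = (0, 9c)`, `phiDescent T' = 18c`).
[folklore] -/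
theorem IsDescentValue.of_T' {c a w : F} (hc : c ≠ 0) (hw : w ≠ 0) (h : 18 * c = a * w ^ 3) :
    IsDescentValue c a := by
  refine ⟨Affine.Point.some 0 (1 * (9 * c)) (nonsingular_T' hc 1 (by norm_num)), w, hw, ?_⟩
  rw [phiDescent_some, if_neg (by
    intro h0; exact (mul_ne_zero (by norm_num : (18 : F) ≠ 0) hc) (by linear_combination h0))]
  linear_combination h

/-- If `(18c)² = a w³` then `a` is a descent value (`P' = −T' = (0, −9c)`, `phiDescent (−T') = (18c)²`).
[folklore] -/
theorem IsDescentValue.of_negT' {c a w : F} (hc : c ≠ 0) (hw : w ≠ 0) (h : (18 * c) ^ 2 = a * w ^ 3) :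
    IsDescentValue c a := by
  refine ⟨Affine.Point.some 0 ((-1) * (9 * c)) (nonsingular_T' hc (-1) (by norm_num)), w, hw, ?_⟩
  rw [phiDescent_some, if_pos (by ring), h]

/-- **Descent values are closed under products** (the descent map is a homomorphism modulo
cubes, `exists_phiDescent_add_eq`). [folklore] -/
theorem IsDescentValue.mul {c a b : F} (hc : c ≠ 0) (ha : a ≠ 0) (hb : b ≠ 0)
    (hA : IsDescentValue c a) (hB : IsDescentValue c b) : IsDescentValue c (a * b) := by
  obtain ⟨P, u, hu, hP⟩ := hA
  obtain ⟨Q, v, hv, hQ⟩ := hB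
  obtain ⟨w, hw, h⟩ := exists_phiDescent_add_eq hc ha hb hu hv hP hQ
  exact ⟨P + Q, w, hw, h⟩

/-- Powers of a descent value are descent values. [folklore] -/
theorem IsDescentValue.pow {c a : F} (hc : c ≠ 0) (ha : a ≠ 0) (hA : IsDescentValue c a) (n : ℕ) :
    IsDescentValue c (a ^ n) := by
  induction n with
  | zero => exact IsDescentValue.of_cube one_ne_zero (by rw [pow_zero, one_pow])
  | succ n ih => rw [pow_succ]; exact ih.mul hc (pow_ne_zero n ha) ha hA

/-- Monomials in descent values are descent values. [folklore] -/
theorem IsDescentValue.prod_pow {c : F} (hc : c ≠ 0) {ι : Type*} (s : Finset ι) {a : ι → F}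
    (ha : ∀ i ∈ s, a i ≠ 0) (h : ∀ i ∈ s, IsDescentValue c (a i)) (n : ι → ℕ) :
    IsDescentValue c (∏ i ∈ s, a i ^ n i) := by
  classical
  induction s using Finset.induction_on with
  | empty => exact IsDescentValue.of_cube one_ne_zero (by rw [Finset.prod_empty, one_pow])
  | insert i s hi ih =>
    rw [Finset.prod_insert hi]
    exact ((h i (Finset.mem_insert_self i s)).pow hc (ha i (Finset.mem_insert_self i s)) (n i)).mul hc
      (pow_ne_zero _ (ha i (Finset.mem_insert_self i s)))
      (Finset.prod_ne_zero_iff.mpr fun j hj => pow_ne_zero _ (ha j (Finset.mem_insert_of_mem hj)))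
      (ih (fun j hj => ha j (Finset.mem_insert_of_mem hj)) (fun j hj => h j (Finset.mem_insert_of_mem hj)))

/-- **Transport along ring homomorphisms of fields** (of characteristic `0`): a point `(X, Y)` of
`E'_{c}(F)` gives the point `(f X, f Y)` of `E'_{f c}(F')`, with `phiDescent (f c) = f ∘ phiDescent c`.
[folklore] -/
theorem IsDescentValue.map {F' : Type*} [Field F'] [CharZero F'] (f : F →+* F') {c a : F} (hc : c ≠ 0)
    (h : IsDescentValue c a) : IsDescentValue (f c) (f a) := by
  obtain ⟨P, w, hw, hP⟩ := h
  have hc' : f c ≠ 0 := (map_ne_zero f).mpr hc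
  rcases P with _ | ⟨X, Y, hXY⟩
  · refine ⟨0, f w, (map_ne_zero f).mpr hw, ?_⟩
    rw [← Affine.Point.zero_def, phiDescent_zero] at hP
    rw [phiDescent_zero, ← map_pow, ← map_mul, ← hP, map_one]
  · have hE : Y ^ 2 = X ^ 3 + 81 * c ^ 2 := (mordellCurve_equation_iff _ _ _).mp hXY.left
    have hE' : (mordellCurve (81 * f c ^ 2)).toAffine.Equation (f X) (f Y) := by
      rw [mordellCurve_equation_iff, ← map_pow, hE]; simp only [map_add, map_pow, map_mul, map_ofNat]
    have hns := nonsingular_mordellCurve_of_equation (mul_ne_zero (by norm_num) (pow_ne_zero 2 hc')) hE'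
    refine ⟨Affine.Point.some _ _ hns, f w, (map_ne_zero f).mpr hw, ?_⟩
    rw [phiDescent_some] at hP ⊢
    by_cases hY : Y = -(9 * c)
    · rw [if_pos hY] at hP
      rw [if_pos (by rw [hY]; simp only [map_neg, map_mul, map_ofNat]), ← map_pow, ← map_mul, ← hP]
      simp only [map_pow, map_mul, map_ofNat]
    · rw [if_neg hY] at hP
      rw [if_neg (fun h0 => hY (f.injective (by rw [h0]; simp only [map_neg, map_mul, map_ofNat]))),
        ← map_pow, ← map_mul, ← hP]
      simp only [map_add, map_mul, map_ofNat]

end Pred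

/-! ## Cubes in `ℤ_p`: Hensel's lemma for `X³ − r` -/

section PadicCubes

open Polynomial

variable {p : ℕ} [hp : Fact p.Prime]

/-- An element of `ℤ_p` with non-zero residue is a unit of norm `1`. [folklore] -/
theorem padicInt_norm_eq_one_of_toZMod_ne_zero {x : ℤ_[p]} (hx : PadicInt.toZMod x ≠ 0) : ‖x‖ = 1 := by
  have : x ∉ RingHom.ker (PadicInt.toZMod : ℤ_[p] →+* ZMod p) := by rwa [RingHom.mem_ker]
  rw [PadicInt.ker_toZMod, IsLocalRing.mem_maximalIdeal, mem_nonunits_iff, not_not] at this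
  exact PadicInt.isUnit_iff.mp this

/-- An element of `ℤ_p` with zero residue has norm `< 1`. [folklore] -/
theorem padicInt_norm_lt_one_of_toZMod_eq_zero {x : ℤ_[p]} (hx : PadicInt.toZMod x = 0) : ‖x‖ < 1 := by
  have : x ∈ RingHom.ker (PadicInt.toZMod : ℤ_[p] →+* ZMod p) := by rwa [RingHom.mem_ker]
  rw [PadicInt.ker_toZMod, IsLocalRing.mem_maximalIdeal, PadicInt.mem_nonunits] at this
  exact this

/-- **Hensel for cubes, `p ≠ 3`**: if `a₀³ ≡ r (mod p)` with `r` a unit then `r` is a cube in `ℤ_p`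
(`F = X³ − r`: `‖F(a₀)‖ < 1 = ‖3a₀²‖²`). Serre, *A Course in Arithmetic*, II.§2.2 (Hensel), cf. the
tree's `padicInt_isSquare_of_toZMod_eq_one`. [folklore] -/
theorem padicInt_exists_pow_three_eq (hp3 : p ≠ 3) {r a₀ : ℤ_[p]} (hr : PadicInt.toZMod r ≠ 0)
    (ha : PadicInt.toZMod a₀ ^ 3 = PadicInt.toZMod r) : ∃ z : ℤ_[p], z ^ 3 = r := by
  set F : Polynomial ℤ_[p] := X ^ 3 - C r with hF
  have hF1 : F.aeval a₀ = a₀ ^ 3 - r := by simp [hF]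
  have hF2 : F.derivative.aeval a₀ = 3 * a₀ ^ 2 := by
    simp [hF]
    norm_num
  have ha0 : PadicInt.toZMod a₀ ≠ 0 := by
    intro h0; rw [h0, zero_pow three_ne_zero] at ha; exact hr ha.symm
  have h3 : ‖(3 : ℤ_[p])‖ = 1 := by
    have hle : ‖((3 : ℤ) : ℤ_[p])‖ ≤ 1 := PadicInt.norm_le_one _
    have hnlt : ¬ ‖((3 : ℤ) : ℤ_[p])‖ < 1 := by
      rw [PadicInt.norm_int_lt_one_iff_dvd]
      intro hd
      have : p ∣ 3 := by exact_mod_cast hd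
      exact hp3 ((Nat.prime_dvd_prime_iff_eq hp.out Nat.prime_three).mp this)
    push_cast at hle hnlt
    linarith [hle, not_lt.mp hnlt]
  have hnorm : ‖F.aeval a₀‖ < ‖F.derivative.aeval a₀‖ ^ 2 := by
    rw [hF1, hF2, norm_mul, h3, one_mul, norm_pow, padicInt_norm_eq_one_of_toZMod_ne_zero ha0, one_pow,
      one_pow]
    apply padicInt_norm_lt_one_of_toZMod_eq_zero
    rw [map_sub, map_pow, ha, sub_self]
  obtain ⟨z, hz, -⟩ := hensels_lemma hnorm
  refine ⟨z, ?_⟩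
  have : z ^ 3 - r = 0 := by simpa [hF] using hz
  exact sub_eq_zero.mp this

/-- Lifting residues: `toZMod (x̄.val) = x̄`. [folklore] -/
theorem padicInt_toZMod_natCast_val (x : ZMod p) : PadicInt.toZMod ((x.val : ℕ) : ℤ_[p]) = x := by
  rw [map_natCast, ZMod.natCast_zmod_val]

/-- **Cubes mod `p` for `p ≢ 1 (mod 3)`**: cubing is onto `(ℤ/p)*` when `3 ∤ p − 1` (it is injective
on the cyclic group of order `p − 1`). [folklore] -/
theorem zmod_exists_pow_three_eq_of_mod_three_ne_one (hp1 : p % 3 ≠ 1) {u : ZMod p} (hu : u ≠ 0) :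
    ∃ a : ZMod p, a ^ 3 = u := by
  have hinj : Function.Injective fun x : (ZMod p)ˣ => x ^ 3 := by
    intro x y hxy
    simp only at hxy
    have h1 : (x * y⁻¹) ^ 3 = 1 := by rw [mul_pow, hxy, inv_pow, mul_inv_cancel]
    have hord : orderOf (x * y⁻¹) ∣ 3 := orderOf_dvd_of_pow_eq_one h1
    have hcard : orderOf (x * y⁻¹) ∣ p - 1 := by
      rw [← ZMod.card_units p]; exact orderOf_dvd_card
    have hne3 : orderOf (x * y⁻¹) ≠ 3 := by
      intro h3
      rw [h3] at hcard
      have hp2 : p ≠ 0 := hp.out.ne_zero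
      have : p % 3 = 1 := by omega
      exact hp1 this
    have h13 : orderOf (x * y⁻¹) = 1 := by
      have := (Nat.dvd_prime Nat.prime_three).mp hord
      tauto
    exact mul_inv_eq_one.mp (orderOf_eq_one_iff.mp h13)
  have hsurj := Finite.surjective_of_injective hinj
  obtain ⟨a, ha⟩ := hsurj (Units.mk0 u hu)
  exact ⟨a, by simpa using congrArg Units.val ha⟩

/-- **Units of `ℤ_p` are cubes when `p ≢ 1 (mod 3)` and `p ≠ 3`** (in particular for `p = 2` and
for Cassels' primes `q ≡ 8 (mod 9)`). [folklore] -/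
theorem padicInt_exists_pow_three_eq_of_mod_three_ne_one (hp3 : p ≠ 3) (hp1 : p % 3 ≠ 1) {r : ℤ_[p]}
    (hr : PadicInt.toZMod r ≠ 0) : ∃ z : ℤ_[p], z ^ 3 = r := by
  obtain ⟨a, ha⟩ := zmod_exists_pow_three_eq_of_mod_three_ne_one hp1 hr
  exact padicInt_exists_pow_three_eq hp3 hr (a₀ := (a.val : ℕ)) (by rw [padicInt_toZMod_natCast_val, ha])

end PadicCubes

/-! ## Cubes in `ℤ₃`: units `≡ ±1 (mod 9)` -/

section ThreeAdicCubes

open Polynomial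

/-- The residues mod `27` of units `≡ ±1 (mod 9)` are cubes mod `27`
(`1, 10, 19 = 1³, 4³, 7³` and their negatives). [folklore] -/
theorem zmod27_exists_cube (u : ZMod 27) (hu : (ZMod.castHom (show 9 ∣ 27 by norm_num) (ZMod 9)) u = 1 ∨
    (ZMod.castHom (show 9 ∣ 27 by norm_num) (ZMod 9)) u = -1) : ∃ a : ZMod 27, a ^ 3 = u := by
  revert u
  decide

/-- **An integer `≡ ±1 (mod 9)` is a cube in `ℤ₃`** (Hensel at precision `27`:
`‖a₀³ − u‖ ≤ 3⁻³ < 3⁻² = ‖3a₀²‖²`). [folklore] -/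
theorem padicInt_three_exists_pow_three_eq {u : ℤ} (hu : u % 9 = 1 ∨ u % 9 = 8) :
    ∃ z : ℤ_[3], z ^ 3 = (u : ℤ_[3]) := by
  haveI : Fact (Nat.Prime 3) := ⟨Nat.prime_three⟩
  -- a residue `a` with `a³ ≡ u (mod 27)`
  have hu' : (ZMod.castHom (show 9 ∣ 27 by norm_num) (ZMod 9)) (u : ZMod 27) = 1 ∨
      (ZMod.castHom (show 9 ∣ 27 by norm_num) (ZMod 9)) (u : ZMod 27) = -1 := by
    rw [map_intCast]
    rcases hu with h | h
    · left
      have h9 : ((9 : ℕ) : ℤ) ∣ u - 1 := by omega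
      have := (ZMod.intCast_zmod_eq_zero_iff_dvd (u - 1) 9).mpr h9
      push_cast at this
      exact sub_eq_zero.mp this
    · right
      have h9 : ((9 : ℕ) : ℤ) ∣ u - (-1) := by omega
      have := (ZMod.intCast_zmod_eq_zero_iff_dvd (u - (-1)) 9).mpr h9
      push_cast at this
      exact sub_eq_zero.mp this
  obtain ⟨a, ha⟩ := zmod27_exists_cube _ hu'
  -- Hensel for `F = X³ − u` at `a₀ = a.val`
  set a₀ : ℤ_[3] := ((a.val : ℕ) : ℤ_[3]) with ha₀
  set F : Polynomial ℤ_[3] := X ^ 3 - C (u : ℤ_[3]) with hF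
  have hF1 : F.aeval a₀ = a₀ ^ 3 - u := by simp [hF]
  have hF2 : F.derivative.aeval a₀ = 3 * a₀ ^ 2 := by
    simp [hF]
    norm_num
  -- `27 ∣ a₀³ − u` in `ℤ`
  have hdvd : ((27 : ℕ) : ℤ) ∣ (a.val : ℤ) ^ 3 - u := by
    rw [← ZMod.intCast_zmod_eq_zero_iff_dvd]
    push_cast
    rw [ZMod.natCast_zmod_val, ha, sub_self]
  have hmem : a₀ ^ 3 - (u : ℤ_[3]) ∈ (Ideal.span {((3 : ℕ) : ℤ_[3]) ^ 3} : Ideal ℤ_[3]) := by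
    obtain ⟨t, ht⟩ := hdvd
    rw [Ideal.mem_span_singleton]
    refine ⟨(t : ℤ_[3]), ?_⟩
    have : ((((a.val : ℤ) ^ 3 - u : ℤ)) : ℤ_[3]) = ((27 * t : ℤ) : ℤ_[3]) := by rw [ht]; push_cast; ring
    push_cast at this
    rw [ha₀]
    push_cast
    linear_combination this
  have hnorm1 : ‖F.aeval a₀‖ ≤ (3 : ℝ) ^ (-3 : ℤ) := by
    rw [hF1]
    exact_mod_cast (PadicInt.norm_le_pow_iff_mem_span_pow (a₀ ^ 3 - (u : ℤ_[3])) 3).2 hmem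
  -- `a₀` is a unit: `a³ = u ≢ 0 (mod 3)`
  have ha0 : PadicInt.toZMod a₀ ≠ 0 := by
    intro h0
    have h3a : (3 : ℤ_[3]) ∣ a₀ := by
      have : a₀ ∈ RingHom.ker (PadicInt.toZMod : ℤ_[3] →+* ZMod 3) := h0
      rw [PadicInt.ker_toZMod, IsLocalRing.mem_maximalIdeal, PadicInt.mem_nonunits] at this
      exact_mod_cast (PadicInt.norm_lt_one_iff_dvd a₀).mp this
    -- then `3 ∣ a₀³`, and with `27 ∣ a₀³ − u`, `3 ∣ u`, contradicting `u ≡ ±1 (mod 9)`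
    have h3u : (3 : ℤ_[3]) ∣ (u : ℤ_[3]) := by
      have h27 : (3 : ℤ_[3]) ∣ a₀ ^ 3 - u := by
        obtain ⟨t, ht⟩ := Ideal.mem_span_singleton.mp hmem
        exact ⟨3 ^ 2 * t, by rw [ht]; push_cast; ring⟩
      have := dvd_sub (dvd_pow h3a three_ne_zero) h27
      rwa [sub_sub_cancel] at this
    have : ‖((u : ℤ) : ℤ_[3])‖ < 1 := (PadicInt.norm_lt_one_iff_dvd _).mpr h3u
    rw [PadicInt.norm_int_lt_one_iff_dvd] at this
    omega
  have hnorm2 : ‖F.derivative.aeval a₀‖ = (3 : ℝ) ^ (-1 : ℤ) := by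
    rw [hF2, norm_mul, norm_pow, padicInt_norm_eq_one_of_toZMod_ne_zero ha0, one_pow, mul_one]
    have := PadicInt.norm_p (p := 3)
    push_cast at this
    rw [this, zpow_neg_one]
  have hnorm : ‖F.aeval a₀‖ < ‖F.derivative.aeval a₀‖ ^ 2 := by
    rw [hnorm2]
    refine lt_of_le_of_lt hnorm1 ?_
    rw [← zpow_natCast, ← zpow_mul]
    exact zpow_lt_zpow_right₀ (by norm_num) (by norm_num)
  obtain ⟨z, hz, -⟩ := hensels_lemma hnorm
  refine ⟨z, ?_⟩
  have : z ^ 3 - (u : ℤ_[3]) = 0 := by simpa [hF] using hz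
  exact sub_eq_zero.mp this

end ThreeAdicCubes


/-! ## The good primes `p ≡ 1 (mod 3)`: lifting from `𝔽_p` to `ℚ_p` -/

section GoodPrime

variable {p : ℕ} [hp : Fact p.Prime]

/-- `√−3 ∈ 𝔽_p` for `p ≡ 1 (mod 3)`: `θ = 2ω + 1` for `ω` of order `3` in `𝔽_p*`. [folklore] -/
theorem zmod_exists_sq_eq_neg_three (hp1 : p % 3 = 1) : ∃ θ : ZMod p, θ ^ 2 = -3 := by
  haveI : Fact (Nat.Prime 3) := ⟨Nat.prime_three⟩
  have h3 : 3 ∣ Fintype.card (ZMod p)ˣ := by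
    rw [ZMod.card_units p]
    have := hp.out.two_le
    omega
  obtain ⟨ω, hω⟩ := exists_prime_orderOf_dvd_card 3 h3
  have hω3 : ((ω : ZMod p)) ^ 3 = 1 := by
    rw [← Units.val_pow_eq_pow_val, ← hω, pow_orderOf_eq_one, Units.val_one]
  have hω1 : (ω : ZMod p) ≠ 1 := by
    intro h
    have : ω = 1 := Units.ext h
    rw [this, orderOf_one] at hω
    norm_num at hω
  have hquad : (ω : ZMod p) ^ 2 + ω + 1 = 0 := by
    have : ((ω : ZMod p) - 1) * ((ω : ZMod p) ^ 2 + ω + 1) = 0 := by linear_combination hω3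
    exact (mul_eq_zero.mp this).resolve_left (sub_ne_zero.mpr hω1)
  exact ⟨2 * ω + 1, by linear_combination (4 : ZMod p) * hquad⟩

/-- `p ≠ 2, 3` from `p ∤ 6`. [folklore] -/
theorem two_three_ne_zero_zmod (hp2 : p ≠ 2) (hp3 : p ≠ 3) : (2 : ZMod p) ≠ 0 ∧ (3 : ZMod p) ≠ 0 := by
  constructor
  · intro h
    have : p ∣ 2 := (ZMod.natCast_eq_zero_iff 2 p).mp (by exact_mod_cast h)
    exact hp2 ((Nat.prime_dvd_prime_iff_eq hp.out Nat.prime_two).mp this)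
  · intro h
    have : p ∣ 3 := (ZMod.natCast_eq_zero_iff 3 p).mp (by exact_mod_cast h)
    exact hp3 ((Nat.prime_dvd_prime_iff_eq hp.out Nat.prime_three).mp this)

/-- Numerals of `ℤ_p` in `ℚ_p`. [folklore] -/
theorem padicInt_coe_ofNat (n : ℕ) [n.AtLeastTwo] :
    ((ofNat(n) : ℤ_[p]) : ℚ_[p]) = ofNat(n) := by
  rw [← Nat.cast_ofNat, PadicInt.coe_natCast, Nat.cast_ofNat]

/-- Residues of integers: `toZMod (n : ℤ_p) = n`. [folklore] -/
theorem padicInt_toZMod_intCast (n : ℤ) : PadicInt.toZMod ((n : ℤ_[p])) = (n : ZMod p) := map_intCast _ n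

/-- A `p`-adic integer `z` with `z³ = r u²` exhibits `r = u (z/u)³` in `ℚ_p` (`u ≠ 0`). [folklore] -/
theorem padic_eq_mul_cube_of_pow_three_eq {r u z : ℤ_[p]} (hu : (u : ℚ_[p]) ≠ 0) (h : z ^ 3 = r * u ^ 2) :
    (r : ℚ_[p]) = u * ((z : ℚ_[p]) / u) ^ 3 := by
  have h' := congrArg ((↑) : ℤ_[p] → ℚ_[p]) h
  push_cast at h'
  rw [div_pow, ← mul_div_assoc, eq_div_iff (pow_ne_zero 3 hu), h']
  ring

/-- **Local solubility at a good prime `p ≡ 1 (mod 3)`** (`p ∤ 6cu`): every `p`-adic unit `u ∈ ℤ`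
is a `φ`-descent value times a cube over `ℚ_p` for `E'_c`, `c ∈ ℤ` a `p`-unit. From the
surjectivity of the descent map on the residue field (`exists_cubicDescent_eq_of_finite`) by Hensel
lifting: `P̄' = O` (`u ≡` cube), `P̄' = ±T̄'` or `X̄ = 0` (`18c/u`, `(18c)²/u ≡` cube: `P' = ±T'`),
and `X̄ ≠ 0`: `Y = u w³ − 9c`, `X³ = Y² − 81c²` solved by Hensel at `X̄`.
[cite: Cassels1964ArithmeticVI, p. 66] -/
theorem padic_isDescentValue_of_good (hp2 : p ≠ 2) (hp3 : p ≠ 3) (hp1 : p % 3 = 1) {c u : ℤ}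
    (hc : ¬ (p : ℤ) ∣ c) (hu : ¬ (p : ℤ) ∣ u) :
    IsDescentValue ((c : ℚ_[p])) ((u : ℚ_[p])) := by
  obtain ⟨h2, h3⟩ := two_three_ne_zero_zmod hp2 hp3
  have hc0 : (c : ZMod p) ≠ 0 := fun h => hc ((ZMod.intCast_zmod_eq_zero_iff_dvd c p).mp h)
  have hu0 : (u : ZMod p) ≠ 0 := fun h => hu ((ZMod.intCast_zmod_eq_zero_iff_dvd u p).mp h)
  have hcQ : (c : ℚ_[p]) ≠ 0 := by
    intro h; apply hc
    have : (c : ℤ) = 0 := by exact_mod_cast h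
    rw [this]; exact dvd_zero _
  have huQ : (u : ℚ_[p]) ≠ 0 := by
    intro h; apply hu
    have : (u : ℤ) = 0 := by exact_mod_cast h
    rw [this]; exact dvd_zero _
  have huZ : ((u : ℤ_[p]) : ℚ_[p]) ≠ 0 := by push_cast; exact huQ
  obtain ⟨θ, hθ⟩ := zmod_exists_sq_eq_neg_three hp1
  obtain ⟨P, w, hw, hP⟩ := exists_cubicDescent_eq_of_finite (k := ZMod p) hθ h2 h3 hc0 (u := (u : ZMod p)) hu0
  have h18 : (18 : ZMod p) ≠ 0 := by
    rw [show (18 : ZMod p) = 2 * 3 * 3 by norm_num]; exact mul_ne_zero (mul_ne_zero h2 h3) h3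
  rcases P with _ | ⟨X, Y, hXY⟩
  · /- `u ≡ (w⁻¹)³`: `u` is a cube in `ℤ_p` -/
    rw [← Affine.Point.zero_def, cubicDescent_zero] at hP
    obtain ⟨z, hz⟩ := padicInt_exists_pow_three_eq hp3 (r := (u : ℤ_[p])) (a₀ := ((w⁻¹ : ZMod p).val : ℕ))
      (by rw [padicInt_toZMod_intCast]; exact hu0)
      (by rw [padicInt_toZMod_natCast_val, padicInt_toZMod_intCast, inv_pow]
          exact (eq_inv_of_mul_eq_one_left hP.symm).symm)
    have hz' := congrArg ((↑) : ℤ_[p] → ℚ_[p]) hz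
    push_cast at hz'
    exact IsDescentValue.of_cube (z := (z : ℚ_[p])) (by
      intro h0; apply huQ; rw [← hz', h0]; ring) hz'.symm
  · have hE : Y ^ 2 = X ^ 3 + 81 * (c : ZMod p) ^ 2 := (mordellCurve_equation_iff _ _ _).mp hXY.left
    rw [cubicDescent_some] at hP
    by_cases hY : Y = -(9 * (c : ZMod p))
    · /- `P̄' = −T̄'`: `(18c)² u² ≡ (uw)³`, so `(18c)² = u z³` in `ℚ_p` -/
      rw [if_pos hY] at hP
      obtain ⟨z, hz⟩ := padicInt_exists_pow_three_eq hp3 (r := ((18 * c) ^ 2 * u ^ 2 : ℤ))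
        (a₀ := ((((u : ZMod p) * w).val : ℕ)))
        (by rw [padicInt_toZMod_intCast]; push_cast
            exact mul_ne_zero (pow_ne_zero 2 (mul_ne_zero h18 hc0)) (pow_ne_zero 2 hu0))
        (by rw [padicInt_toZMod_natCast_val, padicInt_toZMod_intCast]; push_cast
            rw [show (2 : ZMod p) * (9 * (c : ZMod p)) = 18 * c by ring] at hP
            linear_combination -(u : ZMod p) ^ 2 * hP)
      have hz0 : (z : ℚ_[p]) ≠ 0 := by
        intro h0
        rw [PadicInt.coe_eq_zero] at h0
        rw [h0, zero_pow three_ne_zero] at hz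
        have h' := congrArg ((↑) : ℤ_[p] → ℚ_[p]) hz
        push_cast at h'
        have h18 : (18 : ℚ_[p]) * c ≠ 0 := mul_ne_zero (by norm_num) hcQ
        exact (mul_ne_zero (pow_ne_zero 2 h18) (pow_ne_zero 2 huQ)) h'.symm
      refine IsDescentValue.of_negT' hcQ (w := (z : ℚ_[p]) / u) (div_ne_zero hz0 huQ) ?_
      have := padic_eq_mul_cube_of_pow_three_eq (r := ((18 * c) ^ 2 : ℤ)) (u := (u : ℤ)) (z := z) huZ
        (by rw [hz]; push_cast; ring)
      push_cast at this ⊢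
      exact this
    · rw [if_neg hY] at hP
      by_cases hX : X = 0
      · /- `P̄' = T̄'`: `Ȳ = 9c̄`, `18c u² ≡ (uw)³`, so `18c = u z³` -/
        have hY' : Y = 9 * (c : ZMod p) := by
          rcases y_eq_or_of_x_eq_zero (show mordellCurve (81 * (c : ZMod p) ^ 2) = mordellCurve ((9 * (c : ZMod p)) ^ 2)
            by congr 1; ring) hXY.left hX with h | h
          · exact h
          · exact absurd h hY
        obtain ⟨z, hz⟩ := padicInt_exists_pow_three_eq hp3 (r := ((18 * c) * u ^ 2 : ℤ))
          (a₀ := ((((u : ZMod p) * w).val : ℕ)))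
          (by rw [padicInt_toZMod_intCast]; push_cast
              exact mul_ne_zero (mul_ne_zero h18 hc0) (pow_ne_zero 2 hu0))
          (by rw [padicInt_toZMod_natCast_val, padicInt_toZMod_intCast]; push_cast
              rw [hY'] at hP
              linear_combination -(u : ZMod p) ^ 2 * hP)
        have hz0 : (z : ℚ_[p]) ≠ 0 := by
          intro h0
          rw [PadicInt.coe_eq_zero] at h0
          rw [h0, zero_pow three_ne_zero] at hz
          have h' := congrArg ((↑) : ℤ_[p] → ℚ_[p]) hz
          push_cast at h'
          have h18 : (18 : ℚ_[p]) * c ≠ 0 := mul_ne_zero (by norm_num) hcQ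
          exact (mul_ne_zero h18 (pow_ne_zero 2 huQ)) h'.symm
        refine IsDescentValue.of_T' hcQ (w := (z : ℚ_[p]) / u) (div_ne_zero hz0 huQ) ?_
        have := padic_eq_mul_cube_of_pow_three_eq (r := ((18 * c) : ℤ)) (u := (u : ℤ)) (z := z) huZ
          (by rw [hz]; push_cast; ring)
        push_cast at this ⊢
        exact this
      · /- generic: lift `w`, put `Y := u w³ − 9c`, solve `X³ = Y² − 81c²` by Hensel at `X̄` -/
        set wZ : ℤ_[p] := ((w.val : ℕ) : ℤ_[p]) with hwZ
        set YZ : ℤ_[p] := (u : ℤ_[p]) * wZ ^ 3 - ((9 * c : ℤ) : ℤ_[p]) with hYZ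
        have hwres : PadicInt.toZMod wZ = w := padicInt_toZMod_natCast_val w
        have hYres : PadicInt.toZMod YZ = Y := by
          rw [hYZ, map_sub, map_mul, map_pow, hwres, padicInt_toZMod_intCast, padicInt_toZMod_intCast]
          push_cast
          linear_combination -hP
        obtain ⟨XZ, hXZ⟩ := padicInt_exists_pow_three_eq hp3 (r := YZ ^ 2 - ((81 * c ^ 2 : ℤ) : ℤ_[p]))
          (a₀ := ((X.val : ℕ) : ℤ_[p]))
          (by rw [map_sub, map_pow, hYres, padicInt_toZMod_intCast]; push_cast; rw [hE]
              intro h0; exact hX (pow_eq_zero_iff three_ne_zero |>.mp (by linear_combination h0)))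
          (by rw [padicInt_toZMod_natCast_val, map_sub, map_pow, hYres, padicInt_toZMod_intCast]; push_cast
              rw [hE]; ring)
        -- the point `(X, Y)` over `ℚ_p`
        have hXZ' := congrArg ((↑) : ℤ_[p] → ℚ_[p]) hXZ
        push_cast [padicInt_coe_ofNat] at hXZ'
        have hEq : (mordellCurve (81 * (c : ℚ_[p]) ^ 2)).toAffine.Equation (XZ : ℚ_[p]) (YZ : ℚ_[p]) := by
          rw [mordellCurve_equation_iff]
          linear_combination -hXZ'
        have hns := nonsingular_mordellCurve_of_equation (mul_ne_zero (by norm_num) (pow_ne_zero 2 hcQ)) hEq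
        have hwQ : (wZ : ℚ_[p]) ≠ 0 := by
          have : ‖wZ‖ = 1 := padicInt_norm_eq_one_of_toZMod_ne_zero (by rw [hwres]; exact hw)
          intro h0
          rw [PadicInt.coe_eq_zero] at h0
          rw [h0, norm_zero] at this
          exact zero_ne_one this
        refine ⟨Affine.Point.some _ _ hns, (wZ : ℚ_[p]), hwQ, ?_⟩
        have hYQ : (YZ : ℚ_[p]) = (u : ℚ_[p]) * (wZ : ℚ_[p]) ^ 3 - 9 * c := by
          rw [hYZ]; push_cast [padicInt_coe_ofNat]; ring
        have hYne : (YZ : ℚ_[p]) ≠ -(9 * (c : ℚ_[p])) := by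
          intro h0
          have : (YZ : ℚ_[p]) + 9 * c = (u : ℚ_[p]) * (wZ : ℚ_[p]) ^ 3 := by rw [hYQ]; ring
          rw [h0, neg_add_cancel] at this
          exact (mul_ne_zero huQ (pow_ne_zero 3 hwQ)) this.symm
        rw [phiDescent_some, if_neg hYne, hYQ]
        ring

end GoodPrime

/-! ## The other places -/

section OtherPlaces

variable {p : ℕ} [hp : Fact p.Prime]

/-- **Primes `p ≢ 1 (mod 3)`, `p ≠ 3`** (`p = 2`, the good primes `≡ 2 (mod 3)`, and Cassels'
`q ≡ 8 (mod 9)` acting on units): a `p`-adic unit `u ∈ ℤ` is a cube in `ℚ_p`, hence a descent value.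
[cite: Cassels1964ArithmeticVI, p. 66] -/
theorem padic_isDescentValue_of_unit (hp3 : p ≠ 3) (hp1 : p % 3 ≠ 1) (c : ℚ_[p]) {u : ℤ}
    (hu : ¬ (p : ℤ) ∣ u) : IsDescentValue c ((u : ℚ_[p])) := by
  have hu0 : (u : ZMod p) ≠ 0 := fun h => hu ((ZMod.intCast_zmod_eq_zero_iff_dvd u p).mp h)
  obtain ⟨z, hz⟩ := padicInt_exists_pow_three_eq_of_mod_three_ne_one hp3 hp1 (r := (u : ℤ_[p]))
    (by rw [padicInt_toZMod_intCast]; exact hu0)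
  have huQ : (u : ℚ_[p]) ≠ 0 := by
    intro h; apply hu
    have : (u : ℤ) = 0 := by exact_mod_cast h
    rw [this]; exact dvd_zero _
  have hz' := congrArg ((↑) : ℤ_[p] → ℚ_[p]) hz
  push_cast at hz'
  exact IsDescentValue.of_cube (z := (z : ℚ_[p])) (fun h0 => huQ (by rw [← hz', h0]; ring)) hz'.symm

/-- **The primes `q | d`** (`q ≡ 8 (mod 9)`, `d = q d'` with `q ∤ d'`, `c = 12d`): `q` itself is a
descent value, by `P' = T'`: `phiDescent T' = 18c = 216 d = q (6 ∛d')³`, `d'` being a `q`-adic unit,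
hence a cube. [cite: Cassels1964ArithmeticVI, p. 66] -/
theorem padic_isDescentValue_self (hp3 : p ≠ 3) (hp1 : p % 3 ≠ 1) {d d' : ℤ} (hd : d = p * d')
    (hd' : ¬ (p : ℤ) ∣ d') (hd0 : d ≠ 0) : IsDescentValue ((12 * d : ℤ) : ℚ_[p]) ((p : ℤ) : ℚ_[p]) := by
  have hd'0 : (d' : ZMod p) ≠ 0 := fun h => hd' ((ZMod.intCast_zmod_eq_zero_iff_dvd d' p).mp h)
  obtain ⟨z, hz⟩ := padicInt_exists_pow_three_eq_of_mod_three_ne_one hp3 hp1 (r := (d' : ℤ_[p]))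
    (by rw [padicInt_toZMod_intCast]; exact hd'0)
  have hd'Q : (d' : ℚ_[p]) ≠ 0 := by
    intro h; apply hd'
    have : (d' : ℤ) = 0 := by exact_mod_cast h
    rw [this]; exact dvd_zero _
  have hz' := congrArg ((↑) : ℤ_[p] → ℚ_[p]) hz
  push_cast at hz'
  have hzQ : (z : ℚ_[p]) ≠ 0 := fun h0 => hd'Q (by rw [← hz', h0]; ring)
  have hcQ : ((12 * d : ℤ) : ℚ_[p]) ≠ 0 := by
    have : (12 * d : ℤ) ≠ 0 := mul_ne_zero (by norm_num) hd0
    exact_mod_cast this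
  refine IsDescentValue.of_T' hcQ (w := 6 * (z : ℚ_[p])) (mul_ne_zero (by norm_num) hzQ) ?_
  rw [hd]; push_cast
  linear_combination (-216 * (p : ℚ_[p])) * hz'

/-- **`p = 3`**: an integer `u ≡ ±1 (mod 9)` (e.g. a prime `q ≡ 8 (mod 9)`) is a cube in `ℚ₃`,
hence a descent value. [cite: Cassels1964ArithmeticVI, p. 66] -/
theorem padicThree_isDescentValue (c : ℚ_[3]) {u : ℤ} (hu : u % 9 = 1 ∨ u % 9 = 8) :
    IsDescentValue c ((u : ℚ_[3])) := by
  haveI : Fact (Nat.Prime 3) := ⟨Nat.prime_three⟩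
  obtain ⟨z, hz⟩ := padicInt_three_exists_pow_three_eq hu
  have hu0 : (u : ℚ_[3]) ≠ 0 := by
    have : (u : ℤ) ≠ 0 := by rintro rfl; simp at hu
    exact_mod_cast this
  have hz' := congrArg ((↑) : ℤ_[3] → ℚ_[3]) hz
  push_cast at hz'
  exact IsDescentValue.of_cube (z := (z : ℚ_[3])) (fun h0 => hu0 (by rw [← hz', h0]; ring)) hz'.symm

/-- **The real place**: a positive real is a cube, hence a descent value. [folklore] -/
theorem real_isDescentValue (c : ℝ) {u : ℝ} (hu : 0 < u) : IsDescentValue c u :=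
  IsDescentValue.of_cube (z := u ^ ((3 : ℕ) : ℝ)⁻¹) ((Real.rpow_pos_of_pos hu _).ne')
    (Real.rpow_inv_natCast_pow hu.le three_ne_zero).symm

end OtherPlaces


/-! ## Assembly: Cassels' `d` — every monomial in the primes of `d` is locally a descent value -/

section Assembly

open NumberField IsDedekindDomain

/-- **At every prime `ℓ`, each prime `q | d` is a `φ`-descent value times a cube over `ℚ_ℓ`**, for
`d` squarefree with all prime factors `≡ 8 (mod 9)` and `c = 12d` (Cassels p. 66: only `ℓ = 3`
and `ℓ | d` need checking — here: `ℓ = 3`: `q ≡ −1 (mod 9)` is a `3`-adic cube; `ℓ | d`, `ℓ ≠ q`: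
`q` is an `ℓ`-adic unit, a cube as `ℓ ≡ 2 (mod 3)`; `ℓ = q`: `P' = T'`; `ℓ ∤ 3d`, `ℓ ≡ 2 (mod 3)`:
units are cubes; `ℓ ∤ 3d`, `ℓ ≡ 1 (mod 3)`: the good-prime lifting `padic_isDescentValue_of_good`).
[cite: Cassels1964ArithmeticVI, p. 66] -/
theorem padic_isDescentValue_prime {ℓ : ℕ} [hℓ : Fact ℓ.Prime] {d : ℤ} (hd0 : d ≠ 0) (hsq : Squarefree d)
    (h8 : ∀ q : ℕ, q.Prime → (q : ℤ) ∣ d → q % 9 = 8) {q : ℕ} (hq : q.Prime) (hqd : (q : ℤ) ∣ d) :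
    IsDescentValue ((12 * d : ℤ) : ℚ_[ℓ]) ((q : ℤ) : ℚ_[ℓ]) := by
  have hq9 := h8 q hq hqd
  by_cases h3 : ℓ = 3
  · subst h3
    exact padicThree_isDescentValue _ (Or.inr (by omega))
  by_cases hℓd : (ℓ : ℤ) ∣ d
  · have hℓ9 := h8 ℓ hℓ.out hℓd
    have hℓ1 : ℓ % 3 ≠ 1 := by omega
    by_cases hℓq : ℓ = q
    · -- `ℓ = q`: `d = ℓ d'` with `ℓ ∤ d'` (`d` squarefree)
      subst hℓq
      obtain ⟨d', hd'⟩ := hℓd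
      have hnd : ¬ (ℓ : ℤ) ∣ d' := by
        rintro ⟨t, rfl⟩
        have hunit : IsUnit (ℓ : ℤ) := hsq ℓ ⟨t, by rw [hd']; ring⟩
        rcases Int.isUnit_iff.mp hunit with h1 | h1
        · have : ℓ = 1 := by exact_mod_cast h1
          exact hℓ.out.one_lt.ne' this
        · have : (0 : ℤ) ≤ ℓ := Int.natCast_nonneg ℓ
          omega
      exact padic_isDescentValue_self h3 hℓ1 hd' hnd hd0
    · -- `q` is an `ℓ`-adic unit
      refine padic_isDescentValue_of_unit h3 hℓ1 _ fun h => hℓq ?_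
      have : ℓ ∣ q := by exact_mod_cast h
      exact (Nat.prime_dvd_prime_iff_eq hℓ.out hq).mp this
  · have hℓq : ¬ (ℓ : ℤ) ∣ q := fun h => hℓd (h.trans hqd)
    by_cases h1 : ℓ % 3 = 1
    · have h2 : ℓ ≠ 2 := by omega
      have hc : ¬ (ℓ : ℤ) ∣ 12 * d := by
        intro h
        have hprime : Prime (ℓ : ℤ) := Nat.prime_iff_prime_int.mp hℓ.out
        rcases hprime.dvd_or_dvd h with h12 | hdd
        · have : ℓ ∣ 12 := by exact_mod_cast h12
          have hle : ℓ ≤ 12 := Nat.le_of_dvd (by norm_num) this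
          interval_cases ℓ <;> simp_all (config := {decide := true})
        · exact hℓd hdd
      exact padic_isDescentValue_of_good h2 h3 h1 hc hℓq
    · exact padic_isDescentValue_of_unit h3 h1 _ hℓq

/-- **Monomials**: every `∏ qᵢ^{nᵢ}` in primes `qᵢ | d` is a descent value over `ℚ_ℓ`. [folklore] -/
theorem padic_isDescentValue_mono {ℓ : ℕ} [Fact ℓ.Prime] {d : ℤ} (hd0 : d ≠ 0) (hsq : Squarefree d)
    (h8 : ∀ q : ℕ, q.Prime → (q : ℤ) ∣ d → q % 9 = 8) {k : ℕ} (a : Fin k → ℕ) (ha : ∀ i, (a i).Prime)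
    (had : ∀ i, ((a i : ℕ) : ℤ) ∣ d) (n : Fin k → ℕ) :
    IsDescentValue ((12 * d : ℤ) : ℚ_[ℓ]) (∏ i, (((a i : ℕ) : ℤ) : ℚ_[ℓ]) ^ n i) := by
  have hc : ((12 * d : ℤ) : ℚ_[ℓ]) ≠ 0 := by
    have : (12 * d : ℤ) ≠ 0 := mul_ne_zero (by norm_num) hd0
    exact_mod_cast this
  exact IsDescentValue.prod_pow hc Finset.univ (fun i _ => by exact_mod_cast (ha i).ne_zero)
    (fun i _ => padic_isDescentValue_prime hd0 hsq h8 (ha i) (had i)) n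

/-- **The real place**: every such monomial is a descent value over `ℝ` (it is positive). [folklore] -/
theorem real_isDescentValue_mono {d : ℤ} {k : ℕ} (a : Fin k → ℕ) (ha : ∀ i, (a i).Prime) (n : Fin k → ℕ) :
    IsDescentValue ((12 * d : ℤ) : ℝ) (∏ i, (((a i : ℕ) : ℤ) : ℝ) ^ n i) :=
  real_isDescentValue _ (Finset.prod_pos fun i _ => pow_pos (by exact_mod_cast (ha i).pos) _)

/-- **Cassels' local solubility in the shape of the (LOCAL) binder of
`Cassels1964_sha_threeRank_jZero_of_local_global`.** For `d ≠ 0` squarefree with all prime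
factors `≡ 8 (mod 9)`, primes `a₁, …, a_k` dividing `d`, and every `e ∈ (ℤ/3)^k`, the monomial
`m(e) = ∏ aᵢ^{eᵢ}` is a `φ`-descent value times a cube — `phiDescent (12d) P' = m(e) w³` for
some `P' ∈ C'_d(ℚ_v)`, `w ∈ ℚ_v*` — over every completion `ℚ_v` of `ℚ`, finite (`ℚ_v ≃ ℚ_p`,
`Rat.HeightOneSpectrum.adicCompletion.padicEquiv`) and infinite (`≃ ℝ`): "the curves (2)
`m x³ + m⁻¹ y³ + d z³ = 0`, `m | P²`, have rational points everywhere locally" (Cassels' Theorem,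
local half, for every `d` of this form — his `d = p₁⋯p_T q₁⋯q_{I+1}` of (8) included).
[cite: Cassels1964ArithmeticVI, Theorem and p. 66] -/
theorem cassels_torsors_locally_soluble {k : ℕ} (d : ℤ) (hd0 : d ≠ 0) (hsq : Squarefree d)
    (h8 : ∀ q : ℕ, q.Prime → (q : ℤ) ∣ d → q % 9 = 8) (a : Fin k → ℕ) (ha : ∀ i, (a i).Prime)
    (had : ∀ i, ((a i : ℕ) : ℤ) ∣ d) (e : Fin k → ZMod 3) :
    (∀ v : HeightOneSpectrum (𝓞 ℚ),
      ∃ (P : (mordellCurve (81 * algebraMap ℚ (v.adicCompletion ℚ) (12 * (d : ℚ)) ^ 2)).toAffine.Point)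
        (w : v.adicCompletion ℚ), w ≠ 0 ∧
        phiDescent (algebraMap ℚ (v.adicCompletion ℚ) (12 * (d : ℚ))) P =
          algebraMap ℚ (v.adicCompletion ℚ) (∏ i, ((a i : ℕ) : ℚ) ^ (e i).val) * w ^ 3) ∧
    (∀ w : InfinitePlace ℚ,
      ∃ (P : (mordellCurve (81 * algebraMap ℚ w.Completion (12 * (d : ℚ)) ^ 2)).toAffine.Point)
        (t : w.Completion), t ≠ 0 ∧
        phiDescent (algebraMap ℚ w.Completion (12 * (d : ℚ))) P =
          algebraMap ℚ w.Completion (∏ i, ((a i : ℕ) : ℚ) ^ (e i).val) * t ^ 3) := by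
  have hc0 : (12 * d : ℤ) ≠ 0 := mul_ne_zero (by norm_num) hd0
  refine ⟨fun v => ?_, fun w => ?_⟩
  · haveI : Fact ((Rat.HeightOneSpectrum.primesEquiv (R := 𝓞 ℚ) v : ℕ)).Prime :=
      ⟨(Rat.HeightOneSpectrum.primesEquiv (R := 𝓞 ℚ) v).2⟩
    -- the transport map, named before any `CharZero ℚ_v` instance is in scope
    let f : ℚ_[(Rat.HeightOneSpectrum.primesEquiv (R := 𝓞 ℚ) v : ℕ)] →+* v.adicCompletion ℚ :=
      (Rat.HeightOneSpectrum.adicCompletion.padicEquiv (R := 𝓞 ℚ) v).symm.toAlgEquiv.toRingEquiv.toRingHom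
    -- the cast identities are stated before any `CharZero ℚ_v` instance is in scope (the `ℚ`-algebra
    -- structure of `ℚ_v` must stay the `adicCompletion` one, not `DivisionRing.toRatAlgebra`)
    have e1 : algebraMap ℚ (v.adicCompletion ℚ) (12 * (d : ℚ)) = ((12 * d : ℤ) : v.adicCompletion ℚ) := by
      rw [map_mul, map_intCast, map_ofNat]; push_cast; ring
    have e2 : algebraMap ℚ (v.adicCompletion ℚ) (∏ i, ((a i : ℕ) : ℚ) ^ (e i).val) =
        ∏ i, ((a i : ℕ) : v.adicCompletion ℚ) ^ (e i).val := by
      rw [map_prod]; simp only [map_pow, map_natCast]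
    rw [e1, e2]
    have hinj : Function.Injective (algebraMap ℚ (v.adicCompletion ℚ)) :=
      (algebraMap ℚ (v.adicCompletion ℚ)).injective
    haveI : CharZero (v.adicCompletion ℚ) := charZero_of_injective_algebraMap hinj
    have H := (padic_isDescentValue_mono (ℓ := (Rat.HeightOneSpectrum.primesEquiv (R := 𝓞 ℚ) v : ℕ))
      hd0 hsq h8 a ha had fun i => (e i).val).map f (by exact_mod_cast hc0)
    rw [map_intCast, map_prod] at H
    simp only [map_pow, map_natCast, Int.cast_natCast] at H
    exact H
  · let f : ℝ →+* w.Completion :=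
      (InfinitePlace.Completion.ringEquivRealOfIsReal (IsTotallyReal.isReal w)).symm.toRingHom
    have e1 : algebraMap ℚ w.Completion (12 * (d : ℚ)) = ((12 * d : ℤ) : w.Completion) := by
      rw [map_mul, map_intCast, map_ofNat]; push_cast; ring
    have e2 : algebraMap ℚ w.Completion (∏ i, ((a i : ℕ) : ℚ) ^ (e i).val) =
        ∏ i, ((a i : ℕ) : w.Completion) ^ (e i).val := by
      rw [map_prod]; simp only [map_pow, map_natCast]
    rw [e1, e2]
    have hinj : Function.Injective (algebraMap ℚ w.Completion) := (algebraMap ℚ w.Completion).injective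
    haveI : CharZero w.Completion := charZero_of_injective_algebraMap hinj
    have H := (real_isDescentValue_mono (d := d) a ha fun i => (e i).val).map f (by exact_mod_cast hc0)
    rw [map_intCast, map_prod] at H
    simp only [map_pow, map_natCast, Int.cast_natCast] at H
    exact H

end Assembly


end MordellDescent

end Literature.NumberTheory.EllipticCurves

end
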